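import Mathlib.NumberTheory.Transcendental.Liouville.LiouvilleWith
import Literature.NumberTheory.Transcendental.PeriodsWave0
import HarnessLib

/-!
# The record irrationality measure of `ζ(2) = π²/6` (Zudilin 2014)

Topic `Literature/NumberTheory/Irrationality/Zudilin2014`. Typed, cited statement (no proof) of
W. Zudilin, *Two hypergeometric tales and a new irrationality measure of `ζ(2)`*, Ann. Math. Québec **38**
(2014) 101–117 = arXiv:1310.1526 [Zudilin2014ZetaTwo], **Theorem 1**: "The irrationality exponent
`μ(ζ(2))` of `ζ(2) = π²/6` is bounded from above by `5.09541178…`" (previous record `5.44124250…`,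
Rhin–Viola, Acta Arith. 77 (1996)); "Recall that the irrationality exponent `μ(α)` of a real number `α`
is the supremum of the set of exponents `μ` for which the inequality `|α − p/q| < q^{−μ}` has infinitely
many solutions in rationals `p/q`."

Rendering. Mathlib's `LiouvilleWith p x` says that for some `C` there are infinitely many denominators
`n` with a numerator `m`, `x ≠ m/n`, `|x − m/n| < C/n^p`; `μ(x) ≤ c` implies `¬ LiouvilleWith p x` for every
`p > c`. Since the printed constant is `5.09541178…` (an implicitly defined algebraic expression of the
paper, `< 5.09541179`), the statement below — no `LiouvilleWith p` for `p ≥ 5.09541179` — is implied by,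
and slightly weaker than, Theorem 1. `ζ(2) = zetaValue 2` of `PeriodsWave0.lean`.

Cell pub-zeta5 (HONEST FRAMING: systematic search; no irrationality claim unless certified): a RECORD
entry for LITERATURE.md §C (measures); the analogous record `μ(ζ(3)) ≤ 5.513891` (Rhin–Viola 2001) is
not typed until its page is re-read (want filed).
-/

noncomputable section

namespace Literature.NumberTheory.Irrationality.Zudilin2014

open Literature.NumberTheory.Transcendental (zetaValue)

/-- **Zudilin 2014, Theorem 1** (named fact, statement only): `μ(ζ(2)) ≤ 5.09541178…`; rendered as:
for every exponent `p ≥ 5.09541179`, `ζ(2)` is not `p`-Liouville (`¬ LiouvilleWith p (zetaValue 2)`), i.e.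
for every `C` only finitely many `m/n` satisfy `|ζ(2) − m/n| < C/n^p`. [cite: Zudilin2014ZetaTwo, Theorem 1] -/
def zetaTwo_irrationalityExponent_le : Prop :=
  ∀ p : ℝ, (5.09541179 : ℝ) ≤ p → ¬ LiouvilleWith p (zetaValue 2)

end Literature.NumberTheory.Irrationality.Zudilin2014
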